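import Literature.InformationTheory.QuantumCodes.CodeCapacityNoise
import Mathlib.Algebra.BigOperators.Ring.Finset
import Mathlib.Algebra.BigOperators.Field
import Mathlib.Analysis.SpecialFunctions.Pow.Real
import HarnessLib

/-!
# The half-density (Peierls) bound for independent, NON-identically distributed errors

Topic `Literature/InformationTheory/QuantumCodes` (venture QEC, LADDER-QEC rung Q5; qec-type-09 gen 4, item 09.ANISO).
Companion of `PathCountingBound.lean`, whose `sum_bernoulliWeight_halfDense_le` is Dennis–Kitaev–Landahl–Preskill's
eq. (27) for i.i.d. errors of ONE rate `p`: the probability that at least half of the links of a fixed set `T`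
are faulty is `≤ (2√(p(1-p)))^{|T|}`. DKLP's actual noise model has TWO rates ("qubit error probability `p` and
measurement error probability `q`", §5.1; "in any of `2d` directions … `Prob_SAP(H,V) ≤ p̃^{H_e} q̃^{V_e}` summed",
§5.2 eqs. (saw_prob)–(saw_L)), and realistic noise is inhomogeneous. This file PROVES the bound for the tree's
general independent law `indepWeight r` (`CodeCapacityNoise.lean`: location `i` faulty with probability `r i`):

* `sum_indepWeight_mul_pow_eq_prod` — the generating function `Σ_E w_r(E) μ^{|T ∩ E|} = Π_{i ∈ T} (1 - rᵢ + μ rᵢ)`;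
* **`sum_indepWeight_halfDense_le`** — if `0 ≤ rᵢ ≤ ρ ≤ 1/2` for all `i`, then
  `Σ_{E : |T| ≤ 2|T ∩ E|} w_r(E) ≤ (2√(ρ(1-ρ)))^{|T|}`. Proof (Chernoff / exponential Markov, not in DKLP, who
  treat `p = q`): weight each dense `E` by `λ^{|T∩E|} / λ^{|T|/2} ≥ 1` with `λ = (1-ρ)/ρ ≥ 1`, bound the full
  generating function factor by factor, `1 - rᵢ + λ rᵢ ≤ 1 - ρ + λρ = 2(1-ρ)`, and note
  `2(1-ρ)/√λ = 2√(ρ(1-ρ))`. (Termwise comparison with the rate-`ρ` law FAILS — a dense pattern concentrated on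
  the low-rate links is MORE likely than under the homogeneous law — so the i.i.d. proof does not transfer.)
* `sum_indepWeight_le_of_cover` — the union bound over a covering family of link sets (DKLP eq. (28)).
Consumers: the anisotropic (`p ≠ q`) phenomenological toric threshold (`ToricCodePhenomenologicalAnisotropic.lean`)
and the robustness of code-capacity thresholds to site-dependent rates.

## References
* [DennisEtAl2002] E. Dennis, A. Kitaev, A. Landahl, J. Preskill, *Topological quantum memory*, J. Math. Phys. 43
  (2002) 4452–4505, arXiv:quant-ph/0110143, §5.1 eq. (HV_prob), §5.2 eqs. (27), (28), (saw_prob), (saw_L).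
-/

namespace Literature.InformationTheory.QuantumCodes

open Finset

variable {ι : Type*} [Fintype ι] [DecidableEq ι]

/-! ### The generating function of `|T ∩ E|` -/

/-- **Generating function.** For independent errors with rates `r` and a fixed set `T` of locations,
`Σ_E w_r(E) μ^{|T ∩ E|} = Π_{i ∈ T} (1 - rᵢ + μ rᵢ)` (the locations outside `T` integrate out).
[cite: DennisEtAl2002, §5.1 eq. (HV_prob) (independent links, probability p resp. q each)] -/
theorem sum_indepWeight_mul_pow_eq_prod (r : ι → ℝ) (T : Finset ι) (μ : ℝ) :
    ∑ E : Finset ι, indepWeight r E * μ ^ (T ∩ E).card = ∏ i ∈ T, (1 - r i + μ * r i) := by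
  -- expand `Π_i (fᵢ + gᵢ)` over all of `ι` with `fᵢ = [i ∈ T] μ rᵢ` (else `rᵢ`), `gᵢ = 1 - rᵢ`
  have hprod : ∏ i, ((if i ∈ T then μ else 1) * r i + (1 - r i)) = ∏ i ∈ T, (1 - r i + μ * r i) := by
    rw [← Finset.prod_filter_mul_prod_filter_not univ (fun i => i ∈ T)]
    have h1 : univ.filter (fun i => i ∈ T) = T := by ext i; simp
    have h2 : ∏ i ∈ univ.filter (fun i => ¬ i ∈ T), ((if i ∈ T then μ else 1) * r i + (1 - r i)) = 1 :=
      Finset.prod_eq_one fun i hi => by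
        rw [mem_filter] at hi
        rw [if_neg hi.2]; ring
    rw [h2, mul_one, h1]
    exact Finset.prod_congr rfl fun i hi => by rw [if_pos hi]; ring
  rw [← hprod, Finset.prod_add, Finset.powerset_univ]
  refine Finset.sum_congr rfl fun E _ => ?_
  rw [Finset.prod_mul_distrib, indepWeight]
  have hpow : ∏ i ∈ E, (if i ∈ T then μ else (1 : ℝ)) = μ ^ (T ∩ E).card := by
    rw [Finset.prod_ite_mem, Finset.inter_comm, Finset.prod_const]
  rw [hpow]
  ring

/-- Total mass one: `Σ_E w_r(E) = 1`. [cite: DennisEtAl2002, §4.1 (a probability distribution on error chains)] -/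
theorem sum_indepWeight_eq_one (r : ι → ℝ) : ∑ E : Finset ι, indepWeight r E = 1 := by
  have h := sum_indepWeight_mul_pow_eq_prod r ∅ 1
  simpa using h

/-! ### At least half of the links of `T` are faulty: the inhomogeneous bound -/

/-- **Half-density bound for non-identical rates.** If every location is faulty independently with
probability `0 ≤ rᵢ ≤ ρ ≤ 1/2`, then for every set `T` of locations the probability that at least half of
the locations of `T` are faulty is at most `(2√(ρ(1-ρ)))^{|T|}` — DKLP eq. (27) `(4p̃)^{H/2}` with `p̃`
evaluated at the LARGEST rate (exponential-Markov proof with `λ = (1-ρ)/ρ`).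
[cite: DennisEtAl2002, §5.2 eq. (27) with §5.1 (rates p and q)] -/
theorem sum_indepWeight_halfDense_le {r : ι → ℝ} {ρ : ℝ} (hr0 : ∀ i, 0 ≤ r i) (hrρ : ∀ i, r i ≤ ρ)
    (hρ : ρ ≤ 1 / 2) (T : Finset ι) :
    ∑ E ∈ univ.filter (fun E : Finset ι => T.card ≤ 2 * (T ∩ E).card), indepWeight r E ≤
      (2 * Real.sqrt (ρ * (1 - ρ))) ^ T.card := by
  have hρ1 : ∀ i, r i ≤ 1 := fun i => (hrρ i).trans (by linarith)
  have hw : ∀ E : Finset ι, 0 ≤ indepWeight r E := indepWeight_nonneg hr0 hρ1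
  -- degenerate case `ρ ≤ 0`: all rates vanish, only `E = ∅` has weight, and it is dense only if `T = ∅`
  rcases T.eq_empty_or_nonempty with rfl | hT
  · simp only [card_empty, pow_zero]
    calc ∑ E ∈ univ.filter (fun E : Finset ι => 0 ≤ 2 * (∅ ∩ E).card), indepWeight r E
        ≤ ∑ E : Finset ι, indepWeight r E :=
          sum_le_sum_of_subset_of_nonneg (filter_subset _ _) fun E _ _ => hw E
      _ = 1 := sum_indepWeight_eq_one r
  have hρ0 : 0 ≤ ρ := (hr0 hT.choose).trans (hrρ hT.choose)
  rcases hρ0.eq_or_lt with hρz | hρpos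
  · -- `ρ = 0`: every dense `E` meets `T`, hence is non-empty, hence has weight `0`
    have hzero : ∀ E ∈ univ.filter (fun E : Finset ι => T.card ≤ 2 * (T ∩ E).card), indepWeight r E = 0 := by
      intro E hE
      rw [mem_filter] at hE
      have hne : (T ∩ E).Nonempty := by
        rw [← card_pos]
        have := card_pos.2 hT
        omega
      obtain ⟨i, hi⟩ := hne
      have hri : r i = 0 := le_antisymm (hρz ▸ hrρ i) (hr0 i)
      unfold indepWeight
      rw [Finset.prod_eq_zero (mem_inter.1 hi).2 hri, zero_mul]
    rw [sum_congr rfl hzero, sum_const_zero]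
    positivity
  -- main case `0 < ρ ≤ 1/2`
  set lam : ℝ := (1 - ρ) / ρ with hlam
  set σ : ℝ := Real.sqrt (1 - ρ) / Real.sqrt ρ with hσ
  have h1ρ : 0 < 1 - ρ := by linarith
  have hlam1 : 1 ≤ lam := by rw [hlam, le_div_iff₀ hρpos]; linarith
  have hσpos : 0 < σ := by rw [hσ]; exact div_pos (Real.sqrt_pos.2 h1ρ) (Real.sqrt_pos.2 hρpos)
  have hσsq : σ ^ 2 = lam := by
    rw [hσ, div_pow, Real.sq_sqrt h1ρ.le, Real.sq_sqrt hρpos.le, hlam]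
  have hσ1 : 1 ≤ σ := by
    by_contra h
    rw [not_le] at h
    have : σ ^ 2 < 1 := by nlinarith
    rw [hσsq] at this
    linarith
  -- the key identity `2(1-ρ)/σ = 2√(ρ(1-ρ))`
  have hkey : 2 * (1 - ρ) / σ = 2 * Real.sqrt (ρ * (1 - ρ)) := by
    rw [hσ, Real.sqrt_mul hρpos.le, div_div_eq_mul_div]
    have hs : Real.sqrt (1 - ρ) ≠ 0 := (Real.sqrt_pos.2 h1ρ).ne'
    field_simp
    rw [Real.sq_sqrt h1ρ.le]
  -- Step 1: dense `E` gain the factor `σ^{2k - t} ≥ 1`, i.e. `w ≤ w λ^k / σ^t`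
  have hstep : ∀ E ∈ univ.filter (fun E : Finset ι => T.card ≤ 2 * (T ∩ E).card),
      indepWeight r E ≤ indepWeight r E * lam ^ (T ∩ E).card / σ ^ T.card := by
    intro E hE
    rw [mem_filter] at hE
    rw [le_div_iff₀ (pow_pos hσpos _), ← hσsq, ← pow_mul]
    refine mul_le_mul_of_nonneg_left ?_ (hw E)
    exact pow_le_pow_right₀ hσ1 (by omega)
  -- Step 2: sum the gained weights over ALL `E`: the generating function, bounded factor by factor
  have hgf : ∑ E : Finset ι, indepWeight r E * lam ^ (T ∩ E).card ≤ (2 * (1 - ρ)) ^ T.card := by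
    rw [sum_indepWeight_mul_pow_eq_prod]
    calc ∏ i ∈ T, (1 - r i + lam * r i) ≤ ∏ i ∈ T, (2 * (1 - ρ) : ℝ) := by
          refine Finset.prod_le_prod (fun i _ => ?_) (fun i _ => ?_)
          · have := hρ1 i; have := hr0 i; nlinarith
          · have hri := hrρ i
            have : 1 - r i + lam * r i = 1 + (lam - 1) * r i := by ring
            rw [this]
            have hlr : (lam - 1) * r i ≤ (lam - 1) * ρ := mul_le_mul_of_nonneg_left hri (by linarith)
            have hlρ : lam * ρ = 1 - ρ := by rw [hlam]; field_simp
            nlinarith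
      _ = (2 * (1 - ρ)) ^ T.card := Finset.prod_const _
  -- Step 3: assemble
  calc ∑ E ∈ univ.filter (fun E : Finset ι => T.card ≤ 2 * (T ∩ E).card), indepWeight r E
      ≤ ∑ E ∈ univ.filter (fun E : Finset ι => T.card ≤ 2 * (T ∩ E).card),
          indepWeight r E * lam ^ (T ∩ E).card / σ ^ T.card := sum_le_sum hstep
    _ ≤ ∑ E : Finset ι, indepWeight r E * lam ^ (T ∩ E).card / σ ^ T.card :=
        sum_le_sum_of_subset_of_nonneg (filter_subset _ _) fun E _ _ =>
          div_nonneg (mul_nonneg (hw E) (pow_nonneg (by linarith) _)) (pow_nonneg hσpos.le _)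
    _ = (∑ E : Finset ι, indepWeight r E * lam ^ (T ∩ E).card) / σ ^ T.card := by
        rw [Finset.sum_div]
    _ ≤ (2 * (1 - ρ)) ^ T.card / σ ^ T.card := div_le_div_of_nonneg_right hgf (pow_nonneg hσpos.le _)
    _ = (2 * Real.sqrt (ρ * (1 - ρ))) ^ T.card := by rw [← div_pow, hkey]

/-! ### The union bound over a covering family -/

/-- **Peierls union bound, inhomogeneous rates** (DKLP eq. (28) with `p̃` at the largest rate): if every
`E ∈ Bad` is dense on some member `T i`, `i ∈ Ps`, of a finite family of sets, then
`Σ_{E ∈ Bad} w_r(E) ≤ Σ_{i ∈ Ps} (2√(ρ(1-ρ)))^{|T i|}` whenever `0 ≤ rᵢ ≤ ρ ≤ 1/2`.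
[cite: DennisEtAl2002, §5.2 eq. (28)] -/
theorem sum_indepWeight_le_of_cover {κ : Type*} {r : ι → ℝ} {ρ : ℝ} (hr0 : ∀ i, 0 ≤ r i)
    (hrρ : ∀ i, r i ≤ ρ) (hρ : ρ ≤ 1 / 2) (Ps : Finset κ) (T : κ → Finset ι) (Bad : Finset (Finset ι))
    (hcover : ∀ E ∈ Bad, ∃ i ∈ Ps, (T i).card ≤ 2 * (T i ∩ E).card) :
    ∑ E ∈ Bad, indepWeight r E ≤ ∑ i ∈ Ps, (2 * Real.sqrt (ρ * (1 - ρ))) ^ (T i).card := by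
  classical
  have hnn : ∀ E : Finset ι, 0 ≤ indepWeight r E :=
    indepWeight_nonneg hr0 fun i => (hrρ i).trans (by linarith)
  calc ∑ E ∈ Bad, indepWeight r E
      ≤ ∑ E ∈ Bad, ∑ i ∈ Ps, (if (T i).card ≤ 2 * (T i ∩ E).card then indepWeight r E else 0) := by
        refine Finset.sum_le_sum fun E hE => ?_
        obtain ⟨i, hi, hiE⟩ := hcover E hE
        calc indepWeight r E
            = (if (T i).card ≤ 2 * (T i ∩ E).card then indepWeight r E else 0) := by rw [if_pos hiE]
          _ ≤ ∑ i ∈ Ps, (if (T i).card ≤ 2 * (T i ∩ E).card then indepWeight r E else 0) :=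
              Finset.single_le_sum (f := fun i =>
                  if (T i).card ≤ 2 * (T i ∩ E).card then indepWeight r E else 0)
                (fun j _ => by split_ifs <;> simp [hnn E]) hi
    _ = ∑ i ∈ Ps, ∑ E ∈ Bad, (if (T i).card ≤ 2 * (T i ∩ E).card then indepWeight r E else 0) :=
        Finset.sum_comm
    _ ≤ ∑ i ∈ Ps, ∑ E, (if (T i).card ≤ 2 * (T i ∩ E).card then indepWeight r E else 0) := by
        refine Finset.sum_le_sum fun i _ => ?_
        exact Finset.sum_le_sum_of_subset_of_nonneg (Finset.subset_univ _)
          (fun E _ _ => by split_ifs <;> simp [hnn E])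
    _ = ∑ i ∈ Ps, ∑ E ∈ univ.filter (fun E => (T i).card ≤ 2 * (T i ∩ E).card), indepWeight r E := by
        refine Finset.sum_congr rfl fun i _ => ?_
        rw [Finset.sum_filter]
    _ ≤ ∑ i ∈ Ps, (2 * Real.sqrt (ρ * (1 - ρ))) ^ (T i).card :=
        Finset.sum_le_sum fun i _ => sum_indepWeight_halfDense_le hr0 hrρ hρ (T i)

end Literature.InformationTheory.QuantumCodes
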